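import Mathlib.Algebra.MvPolynomial.Funext
import Summits.BirchSwinnertonDyer.Rank1Residual.Supersingular.TernaryFormKernelEvaluator
import Literature.NumberTheory.EllipticCurves.Fisher2014.KleinQuarticTwistSevenCongruence
import Literature.NumberTheory.EllipticCurves.Fisher2012.HesseFamilyThreeReverse
import HarnessLib

/-!
# `7`-congruence certificates in the kernel: rational points of Fisher's `X_E(7)` for the four `p = 7` visibility pairs
# (`100920b1 ← 100920c1`, `366960u1 ← 366960t1`, `411840jx1 ← 411840ke1`, `422370du1 ← 422370dy1`)

Cell `b2b-bsdres` (run/shared/lean/b2b/bsd-rank1-residual/), supersingular family, prover A = unit `b2b-bsdres-x10b` (gen 25).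
Topic file, namespace `Summit.BirchSwinnertonDyer.Rank1Residual.Supersingular`.  THEOREMS + computable DEFINITIONS; no named
fact introduced here; nothing booked; X7 stays CONSTRUCTION-SHAPED.

WHAT THIS FILE DOES.  The N5 visibility offers at `p = 7` (`X7VisibilityRecordsC3/C4` and their twins) display the
`7`-congruence of the rank-2 partner `F` with the target `E` as a HYPOTHESIS `θ : F[7] ≃ E[7]`, `hθ` (Galois-equivariant) —
the congruence itself, evidenced so far only outside the kernel (`a_ℓ(E) ≡ a_ℓ(F) (mod 7)` at all good `ℓ ≤ 3000`,
kit j156242).  Here `θ` is SUPPLIED, modulo ONE published theorem — Fisher 2014, Theorems 4.6 + 4.8 (the family of elliptic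
curves parametrised by `Y_E(7)`; tree fact `Fisher2014.thm48_sevenCongruent_twistQuartic7`) — by a KERNEL CERTIFICATE: a
rational point `P = (x : y : z)` of the twisted Klein quartic `X_E(7) = {𝓕 = 0}` (Fisher's Theorem 3.9 coordinates, `E` in its
`c₄,c₆`-form) and a scaling `u ∈ ℚˣ` with `𝓕(P) = 0`, `d₁(P) ≠ 0`, `H(𝓕)(P) ≠ 0`, `c₄(𝓕)(P) = u⁴·c₄(F)·d₁(P)²`,
`c₆(𝓕)(P) = u⁶·c₆(F)·d₁(P)³` — i.e. the member `E_P` of the family (4.8) is `ℚ`-isomorphic to `F` — each checked by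
`decide +kernel` on exact rational arithmetic.  The evaluation of Klein's covariants `H`, `c₄`, `c₆` (determinants of
partial derivatives, §3.2) at `P` is done WITHOUT symbolic expansion, through the proved calculus identities of
`TernaryFormKernelEvaluator.lean` (`eval_kleinH_eq`, `eval_kleinC4_eq`, `eval_kleinC6_eq` below).
The four points were found EXACTLY, not by search: the partner `F` being known, `P` is the rational solution of `𝓕 = 0`,
`1728 c₄(𝓕)³ − j(F)(c₄(𝓕)³ − c₆(𝓕)²) = 0` (a resultant and rational roots; PARI/GP kit j229162, 12 s; independent exact
Python re-evaluation; cell records `HOME/b2b-bsdres-x10b/gen25/`); in each case it is the unique such point, `X_E⁻(7)` has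
none, and for `100920b1` / `422370du1` it is the image under Fisher's Remark 3.10 of the point found earlier by box search on
the Halberstadt–Kraus quartic (kit j158335 / j158584).  For `366960u1` and `411840jx1` no point was known before (the box
search kit j222983 timed out at 3 h).

HONEST FRAMING (verbatim in every file of the cell): the goal of the cell is to DELETE the COMBINATION-SHAPED residual classes
of the Birch–Swinnerton-Dyer formula for ALL analytic-rank `≤ 1` elliptic curves over `ℚ` — "full BSD formula for every rank
`≤ 1` curve in class `C`" assembled STRICTLY from published theorems — so that the rank-`≤ 1` remainder becomes exactly the
CONSTRUCTION-SHAPED classes, which are TYPED (missing-input `Prop`s), NOT attempted.  This is not "finishing BSD".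

References: T. Fisher, LMS J. Comput. Math. 17 (2014) 536–564, §3.2, Thm. 3.9, Thm. 4.6, Thm. 4.8, Rem. 3.10
[Fisher2014SevenElevenCongruent]; E. Halberstadt, A. Kraus, Experiment. Math. 12 (2003) [HalberstadtKraus2003XE7];
J. H. Silverman, AEC III §1 [SilvermanAEC2009]; Cremona's tables [Cremona2006].
-/

set_option autoImplicit false

open MvPolynomial WeierstrassCurve
open Literature.NumberTheory.EllipticCurves.Fisher2012 (c4c6Model exists_geomTorsion_addEquiv_c4c6Model
  variableChange_shortModel_eq_c4c6Model)
open Literature.NumberTheory.EllipticCurves.Fisher2014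

namespace Summit.BirchSwinnertonDyer.Rank1Residual.Supersingular

open TernaryPoly

/-! ### Computable mirrors of Fisher's `𝓕` (Theorem 3.9) and `d₁` (Theorem 4.8) -/

/-- The twisted Klein quartic `𝓕` of Theorem 3.9 as a sparse polynomial (`Δ = (c₄³ − c₆²)/1728` substituted).
[cite: Fisher2014SevenElevenCongruent, Thm. 3.9 (the quartic F)] -/
def cTwistQuartic7 (c₄ c₆ : ℚ) : Poly :=
  [⟨3, 0, 1, 12⟩, ⟨2, 2, 0, 108⟩, ⟨2, 0, 2, 3 * c₄⟩, ⟨1, 2, 1, 72 * c₄⟩, ⟨0, 4, 0, -(108 * c₄)⟩, ⟨1, 1, 2, -(12 * c₆)⟩,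
    ⟨0, 3, 1, 84 * c₆⟩, ⟨1, 0, 3, c₄ ^ 2⟩, ⟨0, 2, 2, -(15 * c₄ ^ 2)⟩, ⟨0, 1, 3, c₄ * c₆⟩,
    ⟨0, 0, 4, 768 * ((c₄ ^ 3 - c₆ ^ 2) / 1728)⟩]

/-- The cubic form `d₁ = −6(3x² + c₄xz − 3c₄y² + c₆yz)z` of Theorem 4.8 as a sparse polynomial.
[cite: Fisher2014SevenElevenCongruent, Thm. 4.8 (the cubic form d₁)] -/
def cTwistCubic7 (c₄ c₆ : ℚ) : Poly :=
  [⟨2, 0, 1, -18⟩, ⟨1, 0, 2, -(6 * c₄)⟩, ⟨0, 2, 1, 18 * c₄⟩, ⟨0, 1, 2, -(6 * c₆)⟩]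

/-- A vector on `Fin 3` is `![v 0, v 1, v 2]`. [folklore] -/
private theorem vec3_eta (v : Fin 3 → ℚ) : v = ![v 0, v 1, v 2] := by
  ext i; fin_cases i <;> rfl

/-- `toMv (cTwistQuartic7 c₄ c₆) = twistQuartic7 c₄ c₆` (the mirror is faithful). [cite: Fisher2014SevenElevenCongruent, Thm. 3.9] -/
theorem toMv_cTwistQuartic7 (c₄ c₆ : ℚ) : toMv (cTwistQuartic7 c₄ c₆) = twistQuartic7 c₄ c₆ := by
  apply MvPolynomial.funext
  intro v
  rw [vec3_eta v, eval_toMv]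
  simp only [TernaryPoly.eval, cTwistQuartic7, twistQuartic7, List.map_cons, List.map_nil, List.sum_cons, List.sum_nil,
    map_add, map_sub, map_mul, map_pow, eval_C, eval_X, Matrix.cons_val_zero, Matrix.cons_val_one, Matrix.cons_val]
  ring

/-- `toMv (cTwistCubic7 c₄ c₆) = twistCubic7 c₄ c₆`. [cite: Fisher2014SevenElevenCongruent, Thm. 4.8] -/
theorem toMv_cTwistCubic7 (c₄ c₆ : ℚ) : toMv (cTwistCubic7 c₄ c₆) = twistCubic7 c₄ c₆ := by
  apply MvPolynomial.funext
  intro v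
  rw [vec3_eta v, eval_toMv]
  simp only [TernaryPoly.eval, cTwistCubic7, twistCubic7, List.map_cons, List.map_nil, List.sum_cons, List.sum_nil,
    map_add, map_sub, map_mul, map_pow, map_neg, eval_C, eval_X, Matrix.cons_val_zero, Matrix.cons_val_one, Matrix.cons_val]
  ring

/-! ### Numeric evaluation of the partials of a sparse form and of Klein's covariants at a point -/

/-- `∂𝓠/∂x_a (P)` -/
def q₁n (x y z : ℚ) (q : Poly) (a : Fin 3) : ℚ := TernaryPoly.eval x y z (deriv a q)
/-- `∂²𝓠/∂x_a∂x_b (P)` -/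
def q₂n (x y z : ℚ) (q : Poly) (a b : Fin 3) : ℚ := TernaryPoly.eval x y z (deriv a (deriv b q))
/-- third partials at `P` -/
def q₃n (x y z : ℚ) (q : Poly) (a b c : Fin 3) : ℚ := TernaryPoly.eval x y z (deriv a (deriv b (deriv c q)))
/-- fourth partials at `P` -/
def q₄n (x y z : ℚ) (q : Poly) (a b c d : Fin 3) : ℚ :=
  TernaryPoly.eval x y z (deriv a (deriv b (deriv c (deriv d q))))
/-- `H(𝓠)(P)` -/
def hAt (x y z : ℚ) (q : Poly) : ℚ := hVal (-1 / 54) (q₂n x y z q)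
/-- `∂H/∂x_a (P)` -/
def hDerAt (x y z : ℚ) (q : Poly) (a : Fin 3) : ℚ := hDer (-1 / 54) (q₂n x y z q) (q₃n x y z q) a
/-- `∂²H/∂x_b∂x_a (P)` -/
def hDer2At (x y z : ℚ) (q : Poly) (a b : Fin 3) : ℚ := hDer2 (-1 / 54) (q₂n x y z q) (q₃n x y z q) (q₄n x y z q) a b
/-- `c₄(𝓠)(P)` -/
def c4At (x y z : ℚ) (q : Poly) : ℚ := c4Val (1 / 9) (q₂n x y z q) (hDerAt x y z q)
/-- `∂c₄/∂x_a (P)` -/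
def c4DerAt (x y z : ℚ) (q : Poly) (a : Fin 3) : ℚ :=
  c4Der (1 / 9) (q₂n x y z q) (q₃n x y z q) (hDerAt x y z q) (fun i j => hDer2At x y z q j i) a
/-- `c₆(𝓠)(P)` -/
def c6At (x y z : ℚ) (q : Poly) : ℚ := c6Val (1 / 14) (q₁n x y z q) (hDerAt x y z q) (c4DerAt x y z q)

section Links

variable (x y z : ℚ) (q : Poly)

/-- Evaluated partials of `toMv q` are the kernel quantities. [folklore] -/
private theorem ev_d₁ : (fun a => MvPolynomial.eval ![x, y, z] (d₁ (toMv q) a)) = q₁n x y z q := by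
  funext a; simp only [d₁, q₁n, ← toMv_deriv, eval_toMv]

/-- Evaluated partials of `toMv q` are the kernel quantities. [folklore] -/
private theorem ev_d₂ : (fun a b => MvPolynomial.eval ![x, y, z] (d₂ (toMv q) a b)) = q₂n x y z q := by
  funext a b; simp only [d₂, q₂n, ← toMv_deriv, eval_toMv]

/-- Evaluated partials of `toMv q` are the kernel quantities. [folklore] -/
private theorem ev_d₃ : (fun a b c => MvPolynomial.eval ![x, y, z] (d₃ (toMv q) a b c)) = q₃n x y z q := by
  funext a b c; simp only [d₃, q₃n, ← toMv_deriv, eval_toMv]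

/-- Evaluated partials of `toMv q` are the kernel quantities. [folklore] -/
private theorem ev_d₄ : (fun a b c d => MvPolynomial.eval ![x, y, z] (d₄ (toMv q) a b c d)) = q₄n x y z q := by
  funext a b c d; simp only [d₄, q₄n, ← toMv_deriv, eval_toMv]

/-- Symbolic: `H(𝓠) = hVal (−1/54) (∂²𝓠)` (the definition, with the `3 × 3` determinant expanded). [cite: Fisher2014SevenElevenCongruent, §3.2] -/
theorem kleinH_eq (Q : MvPolynomial (Fin 3) ℚ) : kleinH Q = hVal (C (-1 / 54 : ℚ)) (d₂ Q) := by
  rw [kleinH, det_fin_three_eq_det3v, hVal]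
  simp only [Matrix.of_apply, d₂]

/-- Symbolic: `∂H/∂x_a = hDer`. [folklore] -/
theorem pderiv_kleinH_eq (Q : MvPolynomial (Fin 3) ℚ) (a : Fin 3) :
    pderiv a (kleinH Q) = hDer (C (-1 / 54 : ℚ)) (d₂ Q) (d₃ Q) a := by
  rw [kleinH_eq, pderiv_hVal]

/-- Symbolic: `c₄(𝓠) = c4Val (1/9) (∂²𝓠) (∇H)` (the `4 × 4` determinant expanded). [cite: Fisher2014SevenElevenCongruent, §3.2] -/
theorem kleinC4_eq (Q : MvPolynomial (Fin 3) ℚ) :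
    kleinC4 Q = c4Val (C (1 / 9 : ℚ)) (d₂ Q) (fun i => hDer (C (-1 / 54 : ℚ)) (d₂ Q) (d₃ Q) i) := by
  rw [kleinC4, det_fin_four_eq_det4v, c4Val]
  simp only [Matrix.of_apply, Matrix.cons_val', Matrix.cons_val_zero, Matrix.cons_val_one, Matrix.cons_val,
    Matrix.empty_val', Matrix.cons_val_fin_one, pderiv_kleinH_eq, d₂]

/-- Symbolic: `∂c₄/∂x_a = c4Der`. [folklore] -/
theorem pderiv_kleinC4_eq (Q : MvPolynomial (Fin 3) ℚ) (a : Fin 3) :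
    pderiv a (kleinC4 Q) = c4Der (C (1 / 9 : ℚ)) (d₂ Q) (d₃ Q) (fun i => hDer (C (-1 / 54 : ℚ)) (d₂ Q) (d₃ Q) i)
      (fun i j => hDer2 (C (-1 / 54 : ℚ)) (d₂ Q) (d₃ Q) (d₄ Q) j i) a := by
  rw [kleinC4_eq, pderiv_c4Val]

/-- Symbolic: `c₆(𝓠) = c6Val (1/14) (∇𝓠) (∇H) (∇c₄)`. [cite: Fisher2014SevenElevenCongruent, §3.2] -/
theorem kleinC6_eq (Q : MvPolynomial (Fin 3) ℚ) :
    kleinC6 Q = c6Val (C (1 / 14 : ℚ)) (d₁ Q) (fun i => hDer (C (-1 / 54 : ℚ)) (d₂ Q) (d₃ Q) i)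
      (fun a => c4Der (C (1 / 9 : ℚ)) (d₂ Q) (d₃ Q) (fun i => hDer (C (-1 / 54 : ℚ)) (d₂ Q) (d₃ Q) i)
        (fun i j => hDer2 (C (-1 / 54 : ℚ)) (d₂ Q) (d₃ Q) (d₄ Q) j i) a) := by
  rw [kleinC6, det_fin_three_eq_det3v, c6Val]
  simp only [Matrix.of_apply, Matrix.cons_val', Matrix.cons_val_zero, Matrix.cons_val_one, Matrix.cons_val,
    Matrix.empty_val', Matrix.cons_val_fin_one, pderiv_kleinH_eq, pderiv_kleinC4_eq, d₁]

/-- **Kernel evaluation of `H`**: `H(toMv q)(x,y,z) = hAt x y z q`. [folklore] -/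
theorem eval_kleinH_eq : MvPolynomial.eval ![x, y, z] (kleinH (toMv q)) = hAt x y z q := by
  rw [kleinH_eq, map_hVal, eval_C, hAt, ← ev_d₂]

/-- **Kernel evaluation of `c₄`**: `c₄(toMv q)(x,y,z) = c4At x y z q`. [folklore] -/
theorem eval_kleinC4_eq : MvPolynomial.eval ![x, y, z] (kleinC4 (toMv q)) = c4At x y z q := by
  rw [kleinC4_eq, map_c4Val, eval_C, c4At]
  congr 1
  · exact ev_d₂ x y z q
  · funext i
    rw [map_hDer, eval_C, hDerAt, ← ev_d₂, ← ev_d₃]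

/-- **Kernel evaluation of `c₆`**: `c₆(toMv q)(x,y,z) = c6At x y z q`. [folklore] -/
theorem eval_kleinC6_eq : MvPolynomial.eval ![x, y, z] (kleinC6 (toMv q)) = c6At x y z q := by
  rw [kleinC6_eq, map_c6Val, eval_C, c6At]
  congr 1
  · exact ev_d₁ x y z q
  · funext i
    rw [map_hDer, eval_C, hDerAt, ← ev_d₂, ← ev_d₃]
  · funext a
    rw [map_c4Der, eval_C, c4DerAt]
    congr 1
    · exact ev_d₂ x y z q
    · exact ev_d₃ x y z q
    · funext i
      rw [map_hDer, eval_C, hDerAt, ← ev_d₂, ← ev_d₃]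
    · funext i j
      rw [map_hDer2, eval_C, hDer2At, ← ev_d₂, ← ev_d₃, ← ev_d₄]

end Links

/-! ### The certificate theorem -/

/-- From `C • P = c4c6Model (c₄ G) (c₆ G)` and an equivariant `P[7] ≃ W[7]`, an equivariant `G[7] ≃ W[7]` (three
isomorphisms composed; the `n = 7` twin of the plumbing in `Fisher2012/HesseFamilyFiveClosedForms`). [folklore] -/
private theorem sevenCongruent_of_variableChange_eq_c4c6Model (W G P : WeierstrassCurve ℚ)
    (C : VariableChange ℚ) (hC : C • P = c4c6Model G.c₄ G.c₆)
    (hP : ∃ e : geomTorsion P (7 : ℤ) ≃+ geomTorsion W (7 : ℤ),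
      ∀ (σ : Field.absoluteGaloisGroup ℚ) (T : geomTorsion P (7 : ℤ)), e (σ • T) = σ • e T) :
    ∃ e : geomTorsion G (7 : ℤ) ≃+ geomTorsion W (7 : ℤ),
      ∀ (σ : Field.absoluteGaloisGroup ℚ) (T : geomTorsion G (7 : ℤ)), e (σ • T) = σ • e T := by
  obtain ⟨e₁, he₁⟩ := hP
  obtain ⟨e₂, he₂⟩ := exists_geomTorsion_addEquiv_c4c6Model G 7
  have h₃ := P.exists_geomTorsion_addEquiv_smul C 7
  rw [hC] at h₃
  obtain ⟨e₃, he₃⟩ := h₃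
  refine ⟨(e₂.trans e₃.symm).trans e₁, fun σ T => ?_⟩
  simp only [AddEquiv.trans_apply]
  rw [← he₁]
  congr 1
  apply e₃.injective
  rw [AddEquiv.apply_symm_apply, he₃, AddEquiv.apply_symm_apply, he₂]

/-- **`7`-congruence from a kernel certificate on `X_W(7)`.**  Let `W, G` be elliptic curves over `ℚ` with
`c₄(W) = c₄ ≠ 0`, `c₆(W) = c₆ ≠ 0` (`j(W) ≠ 0, 1728`), `c₄(G) = g₄`, `c₆(G) = g₆`, and let `x y z u : ℚ`, `u ≠ 0`, satisfy —
all in exact rational arithmetic, `decide`-able — `𝓕(P) = 0` (`P = (x:y:z) ∈ X_W(7)`, Fisher's Theorem 3.9 quartic),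
`d₁(P) ≠ 0`, `H(𝓕)(P) ≠ 0` (not a point of inflection), `c₄(𝓕)(P) = u⁴·g₄·d₁(P)²` and `c₆(𝓕)(P) = u⁶·g₆·d₁(P)³` (the member
`E_P` of the family (4.8) is `ℚ`-isomorphic to `G` by the scaling `u`).  Then `G[7] ≅ W[7]` as `Γ_ℚ`-modules.  PROVED modulo
Fisher's Theorem 4.8 (`n = 7`, `Y_E(7)`) = the named fact `thm48_sevenCongruent_twistQuartic7`; the evaluation of the
covariants is `eval_kleinH_eq` / `eval_kleinC4_eq` / `eval_kleinC6_eq`, the scaling step is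
`variableChange_shortModel_eq_c4c6Model`. [cite: Fisher2014SevenElevenCongruent, Thm. 4.8 with Thm. 4.6 and Thm. 3.9] -/
theorem sevenCongruent_of_twistCertificate7 (hF : thm48_sevenCongruent_twistQuartic7)
    (W G : WeierstrassCurve ℚ) [W.IsElliptic] [G.IsElliptic] (c₄ c₆ g₄ g₆ x y z u : ℚ)
    (hW4 : W.c₄ = c₄) (hW6 : W.c₆ = c₆) (hG4 : G.c₄ = g₄) (hG6 : G.c₆ = g₆) (h0 : c₄ ≠ 0) (h1728 : c₆ ≠ 0) (hu : u ≠ 0)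
    (hP : TernaryPoly.eval x y z (cTwistQuartic7 c₄ c₆) = 0)
    (hd : TernaryPoly.eval x y z (cTwistCubic7 c₄ c₆) ≠ 0)
    (hH : hAt x y z (cTwistQuartic7 c₄ c₆) ≠ 0)
    (h4 : c4At x y z (cTwistQuartic7 c₄ c₆) = u ^ 4 * g₄ * TernaryPoly.eval x y z (cTwistCubic7 c₄ c₆) ^ 2)
    (h6 : c6At x y z (cTwistQuartic7 c₄ c₆) = u ^ 6 * g₆ * TernaryPoly.eval x y z (cTwistCubic7 c₄ c₆) ^ 3) :
    ∃ e : geomTorsion G (7 : ℤ) ≃+ geomTorsion W (7 : ℤ),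
      ∀ (σ : Field.absoluteGaloisGroup ℚ) (T : geomTorsion G (7 : ℤ)), e (σ • T) = σ • e T := by
  -- translate the kernel quantities into `MvPolynomial.eval` of Fisher's objects
  have eP : MvPolynomial.eval ![x, y, z] (twistQuartic7 W.c₄ W.c₆) = 0 := by
    rw [hW4, hW6, ← toMv_cTwistQuartic7, eval_toMv, hP]
  have ed : MvPolynomial.eval ![x, y, z] (twistCubic7 W.c₄ W.c₆) = TernaryPoly.eval x y z (cTwistCubic7 c₄ c₆) := by
    rw [hW4, hW6, ← toMv_cTwistCubic7, eval_toMv]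
  have eH : MvPolynomial.eval ![x, y, z] (kleinH (twistQuartic7 W.c₄ W.c₆)) ≠ 0 := by
    rw [hW4, hW6, ← toMv_cTwistQuartic7, eval_kleinH_eq]; exact hH
  have e4 : MvPolynomial.eval ![x, y, z] (kleinC4 (twistQuartic7 W.c₄ W.c₆)) =
      u ^ 4 * G.c₄ * TernaryPoly.eval x y z (cTwistCubic7 c₄ c₆) ^ 2 := by
    rw [hW4, hW6, ← toMv_cTwistQuartic7, eval_kleinC4_eq, h4, hG4]
  have e6 : MvPolynomial.eval ![x, y, z] (kleinC6 (twistQuartic7 W.c₄ W.c₆)) =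
      u ^ 6 * G.c₆ * TernaryPoly.eval x y z (cTwistCubic7 c₄ c₆) ^ 3 := by
    rw [hW4, hW6, ← toMv_cTwistQuartic7, eval_kleinC6_eq, h6, hG6]
  -- the member E_P and its identification with G
  have hA4 : -27 * (MvPolynomial.eval ![x, y, z] (kleinC4 (twistQuartic7 W.c₄ W.c₆)) /
      MvPolynomial.eval ![x, y, z] (twistCubic7 W.c₄ W.c₆) ^ 2) = -27 * (u ^ 4 * G.c₄) := by
    rw [e4, ed]; field_simp
  have hA6 : -54 * (MvPolynomial.eval ![x, y, z] (kleinC6 (twistQuartic7 W.c₄ W.c₆)) /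
      MvPolynomial.eval ![x, y, z] (twistCubic7 W.c₄ W.c₆) ^ 3) = -54 * (u ^ 6 * G.c₆) := by
    rw [e6, ed]; field_simp
  have hC : (⟨Units.mk0 u hu, 0, 0, 0⟩ : VariableChange ℚ) • twistMember7 W.c₄ W.c₆ x y z = c4c6Model G.c₄ G.c₆ := by
    rw [twistMember7]
    exact variableChange_shortModel_eq_c4c6Model G _ _ u hu hA4 hA6
  haveI : (twistMember7 W.c₄ W.c₆ x y z).IsElliptic := by
    rw [← inv_smul_smul (⟨Units.mk0 u hu, 0, 0, 0⟩ : VariableChange ℚ) (twistMember7 W.c₄ W.c₆ x y z), hC]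
    infer_instance
  have hd' : MvPolynomial.eval ![x, y, z] (twistCubic7 W.c₄ W.c₆) ≠ 0 := by rw [ed]; exact hd
  exact sevenCongruent_of_variableChange_eq_c4c6Model W G _ _ hC
    (sevenCongruent_twistMember7 hF W x y z (hW4 ▸ h0) (hW6 ▸ h1728) eP hd' eH)

/-! ### The four certificates (Cremona labels; models = Cremona's minimal models) -/

/-- **`100920c1[7] ≅ 100920b1[7]`** (`Γ_ℚ`-modules), from the point `P = (−364565503772 : 412931 : 3)` of `X_E(7)`
(`E = 100920b1`, `c₄ = 761397654544`, `c₆ = 664378921882260928`), `u = 35889946283304918135000000000`,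
`d₁(P) = 8429693347614960000000`; partner `100920c1` (`c₄ = 276544`, `c₆ = −145432448`, rank 2).  Kernel certificate;
conditional only on Fisher's Theorem 4.8.  Resultant kit j229162 (= Remark 3.10 image of the box-search point kit j158335).
[cite: Fisher2014SevenElevenCongruent, Thm. 4.8] [cite: Cremona2006, Table 1 (Cremona labels 100920b1, 100920c1)] -/
theorem sevenCongruent_x7_100920b1_7 (hF : thm48_sevenCongruent_twistQuartic7)
    {W F : WeierstrassCurve ℚ} [W.IsElliptic] [F.IsElliptic]
    (hWeq : W = ⟨0, -1, 0, -15862451136, -768951798028164⟩) (hFeq : F = ⟨0, -1, 0, -5761, 170245⟩) :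
    ∃ e : geomTorsion F (7 : ℤ) ≃+ geomTorsion W (7 : ℤ),
      ∀ (σ : Field.absoluteGaloisGroup ℚ) (T : geomTorsion F (7 : ℤ)), e (σ • T) = σ • e T := by
  refine sevenCongruent_of_twistCertificate7 hF W F 761397654544 664378921882260928 276544 (-145432448)
    (-364565503772) 412931 3 35889946283304918135000000000 ?_ ?_ ?_ ?_ (by norm_num) (by norm_num) (by norm_num)
    (by decide +kernel) (by decide +kernel) (by decide +kernel) (by decide +kernel) (by decide +kernel)
  · subst hWeq; norm_num [WeierstrassCurve.c₄, WeierstrassCurve.b₂, WeierstrassCurve.b₄]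
  · subst hWeq; norm_num [WeierstrassCurve.c₆, WeierstrassCurve.b₂, WeierstrassCurve.b₄, WeierstrassCurve.b₆]
  · subst hFeq; norm_num [WeierstrassCurve.c₄, WeierstrassCurve.b₂, WeierstrassCurve.b₄]
  · subst hFeq; norm_num [WeierstrassCurve.c₆, WeierstrassCurve.b₂, WeierstrassCurve.b₄, WeierstrassCurve.b₆]

/-- **`366960t1[7] ≅ 366960u1[7]`**, from the point `P = (−297010773496 : 857326 : 15)` of `X_E(7)` (`E = 366960u1`,
`c₄ = 121219555216`, `c₆ = 42204539276151616`), `u = 2603030482435374212242931712/5`, `d₁(P) = −4251789138509231616000`;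
partner `366960t1` (`c₄ = 5776`, `c₆ = −1002176`, rank 2).  Kernel certificate; conditional only on Fisher's Theorem 4.8.
Point NEW (resultant kit j229162; the box search kit j222983 had timed out).
[cite: Fisher2014SevenElevenCongruent, Thm. 4.8] [cite: Cremona2006, Table 1 (Cremona labels 366960u1, 366960t1)] -/
theorem sevenCongruent_x7_366960u1_7 (hF : thm48_sevenCongruent_twistQuartic7)
    {W F : WeierstrassCurve ℚ} [W.IsElliptic] [F.IsElliptic]
    (hWeq : W = ⟨0, -1, 0, -2525407400, -48847004581968⟩) (hFeq : F = ⟨0, -1, 0, -120, 1200⟩) :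
    ∃ e : geomTorsion F (7 : ℤ) ≃+ geomTorsion W (7 : ℤ),
      ∀ (σ : Field.absoluteGaloisGroup ℚ) (T : geomTorsion F (7 : ℤ)), e (σ • T) = σ • e T := by
  refine sevenCongruent_of_twistCertificate7 hF W F 121219555216 42204539276151616 5776 (-1002176)
    (-297010773496) 857326 15 (2603030482435374212242931712 / 5) ?_ ?_ ?_ ?_ (by norm_num) (by norm_num) (by norm_num)
    (by decide +kernel) (by decide +kernel) (by decide +kernel) (by decide +kernel) (by decide +kernel)
  · subst hWeq; norm_num [WeierstrassCurve.c₄, WeierstrassCurve.b₂, WeierstrassCurve.b₄]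
  · subst hWeq; norm_num [WeierstrassCurve.c₆, WeierstrassCurve.b₂, WeierstrassCurve.b₄, WeierstrassCurve.b₆]
  · subst hFeq; norm_num [WeierstrassCurve.c₄, WeierstrassCurve.b₂, WeierstrassCurve.b₄]
  · subst hFeq; norm_num [WeierstrassCurve.c₆, WeierstrassCurve.b₂, WeierstrassCurve.b₄, WeierstrassCurve.b₆]

/-- **`411840ke1[7] ≅ 411840jx1[7]`**, from the point `P = (−1349471616 : −56960 : 1)` of `X_E(7)` (`E = 411840jx1`,
`c₄ = −1426593024`, `c₆ = 156338129396736`), `u = 4646732100876370494582423552`, `d₁(P) = −74213046781252042752`; partner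
`411840ke1` (`c₄ = 31657536`, `c₆ = −178547894784`, rank 2).  Kernel certificate; conditional only on Fisher's Theorem 4.8.
Point NEW (resultant kit j229162).
[cite: Fisher2014SevenElevenCongruent, Thm. 4.8] [cite: Cremona2006, Table 1 (Cremona labels 411840jx1, 411840ke1)] -/
theorem sevenCongruent_x7_411840jx1_7 (hF : thm48_sevenCongruent_twistQuartic7)
    {W F : WeierstrassCurve ℚ} [W.IsElliptic] [F.IsElliptic]
    (hWeq : W = ⟨0, 0, 0, 29720688, -180946909024⟩) (hFeq : F = ⟨0, 0, 0, -659532, 206652656⟩) :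
    ∃ e : geomTorsion F (7 : ℤ) ≃+ geomTorsion W (7 : ℤ),
      ∀ (σ : Field.absoluteGaloisGroup ℚ) (T : geomTorsion F (7 : ℤ)), e (σ • T) = σ • e T := by
  refine sevenCongruent_of_twistCertificate7 hF W F (-1426593024) 156338129396736 31657536 (-178547894784)
    (-1349471616) (-56960) 1 4646732100876370494582423552 ?_ ?_ ?_ ?_ (by norm_num) (by norm_num) (by norm_num)
    (by decide +kernel) (by decide +kernel) (by decide +kernel) (by decide +kernel) (by decide +kernel)
  · subst hWeq; norm_num [WeierstrassCurve.c₄, WeierstrassCurve.b₂, WeierstrassCurve.b₄]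
  · subst hWeq; norm_num [WeierstrassCurve.c₆, WeierstrassCurve.b₂, WeierstrassCurve.b₄, WeierstrassCurve.b₆]
  · subst hFeq; norm_num [WeierstrassCurve.c₄, WeierstrassCurve.b₂, WeierstrassCurve.b₄]
  · subst hFeq; norm_num [WeierstrassCurve.c₆, WeierstrassCurve.b₂, WeierstrassCurve.b₄, WeierstrassCurve.b₆]

/-- **`422370dy1[7] ≅ 422370du1[7]`**, from the point `P = (−37749902011563 : 5677789 : 2)` of `X_E(7)` (`E = 422370du1`,
`c₄ = 85546537010289`, `c₆ = 799548483847727388663`), `u = 288443229422047549861158404115333120000`,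
`d₁(P) = 16531336020446101488245760000`; partner `422370dy1` (`c₄ = 3249`, `c₆ = −1892457`, rank 2).  Kernel certificate;
conditional only on Fisher's Theorem 4.8.  Resultant kit j229162 (= Remark 3.10 image of the box-search point kit j158584).
Consumers: the offers `bsdp_x7r0vis[5]…_422370du1_7_of_congr` (`X7VisibilityRecordsC6`, `X7Visibility5Records07` and their twins).
[cite: Fisher2014SevenElevenCongruent, Thm. 4.8] [cite: Cremona2006, Table 1 (Cremona labels 422370du1, 422370dy1)] -/
theorem sevenCongruent_x7_422370du1_7 (hF : thm48_sevenCongruent_twistQuartic7)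
    {W F : WeierstrassCurve ℚ} [W.IsElliptic] [F.IsElliptic]
    (hWeq : W = ⟨1, -1, 1, -1782219521048, -925402892231841253⟩) (hFeq : F = ⟨1, -1, 1, -68, 2207⟩) :
    ∃ e : geomTorsion F (7 : ℤ) ≃+ geomTorsion W (7 : ℤ),
      ∀ (σ : Field.absoluteGaloisGroup ℚ) (T : geomTorsion F (7 : ℤ)), e (σ • T) = σ • e T := by
  refine sevenCongruent_of_twistCertificate7 hF W F 85546537010289 799548483847727388663 3249 (-1892457)
    (-37749902011563) 5677789 2 288443229422047549861158404115333120000 ?_ ?_ ?_ ?_ (by norm_num) (by norm_num)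
    (by norm_num) (by decide +kernel) (by decide +kernel) (by decide +kernel) (by decide +kernel) (by decide +kernel)
  · subst hWeq; norm_num [WeierstrassCurve.c₄, WeierstrassCurve.b₂, WeierstrassCurve.b₄]
  · subst hWeq; norm_num [WeierstrassCurve.c₆, WeierstrassCurve.b₂, WeierstrassCurve.b₄, WeierstrassCurve.b₆]
  · subst hFeq; norm_num [WeierstrassCurve.c₄, WeierstrassCurve.b₂, WeierstrassCurve.b₄]
  · subst hFeq; norm_num [WeierstrassCurve.c₆, WeierstrassCurve.b₂, WeierstrassCurve.b₄, WeierstrassCurve.b₆]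

end Summit.BirchSwinnertonDyer.Rank1Residual.Supersingular
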